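import Literature.NumberTheory.LFunctions.RealCharacterDivisorSums
import Literature.NumberTheory.LFunctions.MertensElementary
import Mathlib.NumberTheory.LSeries.Nonvanishing
import Mathlib.NumberTheory.LSeries.DirichletContinuation
import Mathlib.Analysis.SpecialFunctions.Pow.Real
import Mathlib.Analysis.SpecialFunctions.Log.Basic
import Mathlib.Analysis.SpecialFunctions.Sqrt
import HarnessLib

/-!
# The size of `L(1, χ)` against the width `1 − β` of the zero-free interval
# (Friedlander–Iwaniec 2018, "A note on Dirichlet `L`-functions": Proposition 2.1, (3.7), (4.1),
# Theorem 2, Theorem 3)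

Topic `Literature/NumberTheory/LFunctions` (namespace `Literature.NumberTheory.LFunctions`; the
note's objects in the sub-namespace `FI2018`). STATEMENT LAYER (D-0014) for the cell `landau-siegel`
(rung F-S3, §C harvest row T-077 / P-088, tag DH — the dictionary `η ↔ L(1,χ)`, Hecke's converse
direction): THREE named facts (Proposition 2.1; the Deuring–Heilbronn bound (3.7); the conditional
Theorem 3 (6.3)) and PROVED consequences exactly as the note derives them: (4.1) from (2.2)+(3.7),
Theorem 2 from (4.1), and (6.6) from (6.5)-shape bounds. The tree already has the cruder two-sided
dictionary `|1 − β₁| ≪ L(1,χ) ≪ (1 − β₁)(log q)²` (Montgomery–Vaughan (11.10):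
`MontgomeryVaughan2007_thm11_4_LOne_exceptional_holds`, `ExceptionalZeroOfSmallLOne.lean`) and the
hyperbola-method bound `L(1,χ) ≤ (1−β) Σ_{n≤N} r(n)/n + 10q/⌊√N⌋` (`ExceptionalZeroLOneBound.lean`,
PROVED); Hecke's Theorem 1 of the note is `MontgomeryVaughan2007_thm11_4_LOne_holds` — cited, not
retyped. This file adds the `log η` refinement (4.1) and the "ultimate Deuring–Heilbronn" Theorem 3.

## What the source prints (held text `paper:arxiv-1701.03771`, corpus-tex, 8 chunks, read 2026-08-26)

J. B. Friedlander, H. Iwaniec, *A note on Dirichlet `L`-functions*, Expo. Math. 36 (2018) 343–350,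
doi:10.1016/j.exmath.2018.06.003 = arXiv:1701.03771 [FriedlanderIwaniec2018Note].

§1 (p0002): "Let `χ (mod D)` be a real, primitive character of conductor `D` … the largest real
zero, say `β`, of `L(s,χ)`." **Theorem 2.** "If `L(s,χ)` has a real zero `β` with
`1 − β ≪ (log D)^{−3} log log D` (1.7), then (1.6) [`L(1,χ) ≪ (log D)^{−1}`] holds."
§2 (p0003): "From now on we assume that `1 − β ≤ (3 log D)^{−1}`. Denote `λ = 1 ∗ χ` and …
`S(x) = Σ_{n ≤ x} λ(n)(1 − n/x) n^{−β}` (2.1) … **Proposition 2.1.** Assume `L(s,χ)` has a real zero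
`β` with `1 − β ≤ (3 log D)^{−1}`. Then `L(1,χ) ≍ (1 − β) S(D)` (2.2)."
§3 (p0004): "`η = 1/((1−β) log D) ≥ 3` (3.5) … [Deuring–Heilbronn, Bombieri Théorème 16; Heath-Brown
1983 Lemma 3: `T(D) ≪ (log η)^{−1/2} log D` (3.6)] … `S(D) ≪ (log η)^{−1} (log D)²` (3.7)."
§4 (p0005): "From (2.2) and (3.7) we get `L(1,χ) ≪ ((1−β)/log η) (log D)²` (4.1). In particular, if
`β` satisfies (1.7) then `η ≫ log D` and (4.1) gives (1.6)."
§6 (p0007): "Let us assume that `β > 3/4` is the only zero of `L(s,χ)` in `Re s > 3/4`. …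
`L(1,χ) ≍ ω exp(Σ_{p ≤ log D} χ(p) p^{−1})` (6.3) where `ω = min{1, (1−β) log log D}` (6.4). This
proves **Theorem 3.** Assuming that `β > 3/4` is the only zero of `L(s,χ)` in `Re s > 3/4` we have
(6.3). Hence `ω (log log D)^{−1} ≪ L(1,χ) ≪ ω log log D` (6.5). In particular, if
`1 − β ≪ (log log D)^{−1}`, then `1 − β ≪ L(1,χ) ≪ (1 − β)(log log D)²` (6.6)."
Author-named obstruction (p0002): "The limitation in the bound of Theorem 2 comes from our imperfect
knowledge about the complex zeros."

## Lean rendering / design choices (audit notes for ls-lit-ref)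

* "real primitive character of conductor `D`": `χ : DirichletCharacter ℂ D`, `χ.IsPrimitive`,
  `χ.IsQuadratic`, with `3 ≤ D`; `L(1,χ)` (real, positive) is `‖χ.LFunction 1‖`; "real zero `β`" is
  `χ.LFunction β = 0` with `β : ℝ`, and the standing `1 − β ≤ (3 log D)^{−1}` is carried VERBATIM
  together with `β < 1` (printed implicitly: `β` is a zero, `L(1,χ) ≠ 0`).
* `λ = 1 ∗ χ` is the tree's real arithmetic function `RealChar.charDivisorSum χ`
  (`r(n) = Σ_{d∣n} Re χ(d)`, `RealCharacterDivisorSums.lean`); `S(x)` = `FI2018.smoothSum`.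
* `≍`, `≪` with ABSOLUTE implied constants (nothing else is in play) are rendered `∃ c > 0 …`
  outermost; since the note argues asymptotically in `D` ("`O(x^{−1} D^{1/2} log D)`" in the proof
  of (2.2)), every statement carries `∃ D₀, ∀ D ≥ D₀` — the weaker reading (for `D < D₀` there are
  finitely many characters, each with at most one such `β`, so constants could be adjusted; not
  claimed). "`1 − β ≪ f(D)` ⇒ `L(1,χ) ≪ g(D)`" (Theorem 2, (6.6)) is `∀ A > 0, ∃ C > 0, …`.
* `η = 1/((1 − β) log D)`, `ω = min{1, (1 − β) log log D}`, `Σ_{p ≤ log D} χ(p)/p` over the primes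
  `p ≤ ⌊log D⌋` with `Re χ(p)` (`χ` is real): `FI2018.eta`, `FI2018.omega`, `FI2018.primeSum`.
* Theorem 3's hypothesis "`β > 3/4` is the only zero of `L(s,χ)` in `Re s > 3/4`":
  `FI2018.OnlyZeroBeyond χ β` — `3/4 < β`, `L(β,χ) = 0`, and every zero with real part `> 3/4` equals
  `β` (as a point; multiplicity is not mentioned in print and not constrained here).

WHAT THIS IS NOT: no claim that an exceptional zero exists; Theorem 3 is CONDITIONAL on a GRH-type
hypothesis carried explicitly; Heath-Brown's Lemma 3 ((3.6)) and Bombieri's repulsion are inputs of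
the printed proof of (3.7), not typed separately here (the tree's DH: `deuring_heilbronn`,
`logFreeDensityDH`).

## References

* [FriedlanderIwaniec2018Note] J. B. Friedlander, H. Iwaniec, Expo. Math. 36 (2018) 343–350 =
  arXiv:1701.03771: §1 Thm 2 (p0002), §2 Prop 2.1 (p0003), §3 (3.5)–(3.7) (p0004), §4 (4.1) (p0005),
  §6 Thm 3, (6.3)–(6.6) (p0007).
* [MontgomeryVaughan2007] H. L. Montgomery, R. C. Vaughan, *Multiplicative Number Theory I*, CUP 2007,
  Theorem 11.4 (11.10) (the tree's cruder dictionary).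
-/

noncomputable section

open Finset Filter Real

namespace Literature.NumberTheory.LFunctions

namespace FI2018

/-- **`S(x) = Σ_{n ≤ x} λ(n)(1 − n/x) n^{−β}`**, `λ = 1 ∗ χ` (the tree's `RealChar.charDivisorSum χ`),
the smoothly cropped sum (2.1) of the note (used at `x = D`).
[cite: FriedlanderIwaniec2018Note, §2 (2.1)] -/
def smoothSum {D : ℕ} (χ : DirichletCharacter ℂ D) (β x : ℝ) : ℝ :=
  ∑ n ∈ Icc 1 ⌊x⌋₊, RealChar.charDivisorSum χ n * (1 - (n : ℝ) / x) * (n : ℝ) ^ (-β)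

/-- **`η = 1/((1 − β) log D)`** ((3.5); `≥ 3` under the standing assumption
`1 − β ≤ (3 log D)^{−1}`). [cite: FriedlanderIwaniec2018Note, §3 (3.5)] -/
def eta (D : ℕ) (β : ℝ) : ℝ := 1 / ((1 - β) * Real.log D)

/-- **`ω = min{1, (1 − β) log log D}`** ((6.4)). [cite: FriedlanderIwaniec2018Note, §6 (6.4)] -/
def omega (D : ℕ) (β : ℝ) : ℝ := min 1 ((1 - β) * Real.log (Real.log D))

/-- **`Σ_{p ≤ log D} χ(p)/p`** (over the primes `p ≤ ⌊log D⌋`; `χ` real, so `χ(p) = Re χ(p)`).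
[cite: FriedlanderIwaniec2018Note, §6 (6.3)] -/
def primeSum {D : ℕ} (χ : DirichletCharacter ℂ D) : ℝ :=
  ∑ p ∈ (Icc 1 ⌊Real.log D⌋₊).filter Nat.Prime, (χ (p : ZMod D)).re / p

/-- The standing data of §§2–4: `χ` real primitive of conductor `D ≥ 3` and `β < 1` a real zero of
`L(s,χ)` with `1 − β ≤ (3 log D)^{−1}` ("From now on we assume that `1 − β ≤ (3 log D)^{−1}`").
[cite: FriedlanderIwaniec2018Note, §2] -/
structure IsCloseRealZero {D : ℕ} [NeZero D] (χ : DirichletCharacter ℂ D) (β : ℝ) : Prop where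
  three_le : 3 ≤ D
  isPrimitive : χ.IsPrimitive
  isQuadratic : χ.IsQuadratic
  zero : χ.LFunction (β : ℂ) = 0
  lt_one : β < 1
  close : 1 - β ≤ 1 / (3 * Real.log D)

/-- Theorem 3's hypothesis: "`β > 3/4` is the only zero of `L(s,χ)` in `Re s > 3/4`" (GRH for
`L(s,χ)` apart from one real zero), for a real primitive `χ` of conductor `D ≥ 3`.
[cite: FriedlanderIwaniec2018Note, §6 Theorem 3] -/
structure OnlyZeroBeyond {D : ℕ} [NeZero D] (χ : DirichletCharacter ℂ D) (β : ℝ) : Prop where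
  three_le : 3 ≤ D
  isPrimitive : χ.IsPrimitive
  isQuadratic : χ.IsQuadratic
  lt : 3 / 4 < β
  zero : χ.LFunction (β : ℂ) = 0
  only : ∀ s : ℂ, 3 / 4 < s.re → χ.LFunction s = 0 → s = (β : ℂ)

/-- A zero beyond `3/4` that is the only one is in particular real and `< 1` is not needed below;
we record the trivial unfolding `OnlyZeroBeyond χ β → χ.LFunction β = 0`.
[cite: FriedlanderIwaniec2018Note, §6 Theorem 3] -/
theorem OnlyZeroBeyond.lfunction_eq_zero {D : ℕ} [NeZero D] {χ : DirichletCharacter ℂ D} {β : ℝ}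
    (h : OnlyZeroBeyond χ β) : χ.LFunction (β : ℂ) = 0 := h.zero

end FI2018

open FI2018

/-- **Friedlander–Iwaniec 2018, Proposition 2.1** (NAMED FACT, AS PRINTED, (2.2)): for a real
primitive `χ` of conductor `D` with a real zero `β`, `1 − β ≤ (3 log D)^{−1}`,
`L(1,χ) ≍ (1 − β) S(D)` — absolute implied constants, `D` large. (Proof in print: contour
integration of `ζ(s)L(s,χ)`, `S(x) = L(1,χ) x^{1−β}/((1−β)(2−β)) + O(x^{−1}D^{1/2} log D)`.)
[cite: FriedlanderIwaniec2018Note, §2 Proposition 2.1 (2.2)] -/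
def fi2018_proposition21 : Prop :=
  ∃ c₁ c₂ : ℝ, 0 < c₁ ∧ 0 < c₂ ∧ ∃ D₀ : ℕ, ∀ (D : ℕ) [NeZero D], D₀ ≤ D →
    ∀ (χ : DirichletCharacter ℂ D) (β : ℝ), IsCloseRealZero χ β →
      c₁ * ((1 - β) * smoothSum χ β D) ≤ ‖χ.LFunction 1‖ ∧
        ‖χ.LFunction 1‖ ≤ c₂ * ((1 - β) * smoothSum χ β D)

/-- **Friedlander–Iwaniec 2018, (3.7)** (NAMED FACT, AS PRINTED): under the same standing data,
`S(D) ≪ (log η)^{−1} (log D)²`, `η = 1/((1−β) log D) ≥ 3` — the step that uses the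
Deuring–Heilbronn repulsion (Bombieri, Théorème 16) through Heath-Brown's Lemma 3
`T(D) = Σ_{p ≤ D} λ(p) log p / p ≪ (log η)^{−1/2} log D` (3.6) and the choice
`log B = (log η)^{−1/2} log D`. [cite: FriedlanderIwaniec2018Note, §3 (3.5)–(3.7)] -/
def fi2018_eq37 : Prop :=
  ∃ C : ℝ, 0 < C ∧ ∃ D₀ : ℕ, ∀ (D : ℕ) [NeZero D], D₀ ≤ D →
    ∀ (χ : DirichletCharacter ℂ D) (β : ℝ), IsCloseRealZero χ β →
      smoothSum χ β D ≤ C * Real.log D ^ 2 / Real.log (eta D β)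

/-- **Friedlander–Iwaniec 2018, Theorem 3 (6.3)** (NAMED FACT, AS PRINTED; CONDITIONAL — the
hypothesis is carried, nothing is asserted about its truth): if `β > 3/4` is the only zero of
`L(s,χ)` in `Re s > 3/4` (`χ` real primitive of conductor `D`), then
`L(1,χ) ≍ ω · exp(Σ_{p ≤ log D} χ(p)/p)`, `ω = min{1, (1−β) log log D}` — absolute constants, `D`
large ("the Ultimate Deuring–Heilbronn Phenomenon", after Littlewood 1928).
[cite: FriedlanderIwaniec2018Note, §6 Theorem 3 (6.3)–(6.4)] -/
def fi2018_theorem3 : Prop :=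
  ∃ c₁ c₂ : ℝ, 0 < c₁ ∧ 0 < c₂ ∧ ∃ D₀ : ℕ, ∀ (D : ℕ) [NeZero D], D₀ ≤ D →
    ∀ (χ : DirichletCharacter ℂ D) (β : ℝ), OnlyZeroBeyond χ β →
      c₁ * (omega D β * Real.exp (primeSum χ)) ≤ ‖χ.LFunction 1‖ ∧
        ‖χ.LFunction 1‖ ≤ c₂ * (omega D β * Real.exp (primeSum χ))

namespace FI2018

/-- Under the standing assumption, `1 − β > 0` is automatic? No — it is `β < 1`, carried in the
structure; here: `0 < 1 − β`. [cite: FriedlanderIwaniec2018Note, §2] -/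
theorem IsCloseRealZero.sub_pos {D : ℕ} [NeZero D] {χ : DirichletCharacter ℂ D} {β : ℝ}
    (h : IsCloseRealZero χ β) : 0 < 1 - β := by linarith [h.lt_one]

/-- Under the standing assumption `η ≥ 3` ((3.5)): `1 − β ≤ 1/(3 log D)` with `log D > 0` gives
`(1 − β) log D ≤ 1/3`, i.e. `η = 1/((1−β) log D) ≥ 3`. [cite: FriedlanderIwaniec2018Note, §3 (3.5)] -/
theorem IsCloseRealZero.three_le_eta {D : ℕ} [NeZero D] {χ : DirichletCharacter ℂ D} {β : ℝ}
    (h : IsCloseRealZero χ β) : 3 ≤ eta D β := by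
  have hD : (3 : ℝ) ≤ D := by exact_mod_cast h.three_le
  have hlog : 0 < Real.log D := Real.log_pos (by linarith)
  have hb := h.sub_pos
  have hprod : 0 < (1 - β) * Real.log D := mul_pos hb hlog
  unfold eta
  rw [le_div_iff₀ hprod]
  have := h.close
  rw [le_div_iff₀ (by positivity)] at this
  linarith

/-- **(4.1) from (2.2) and (3.7)** (PROVED, as printed: "From (2.2) and (3.7) we get (4.1)"):
`L(1,χ) ≤ C (1 − β)(log D)²/log η` for `D` large, under the standing data.
[cite: FriedlanderIwaniec2018Note, §4 (4.1)] -/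
theorem eq41_of (h21 : fi2018_proposition21) (h37 : fi2018_eq37) :
    ∃ C : ℝ, 0 < C ∧ ∃ D₀ : ℕ, ∀ (D : ℕ) [NeZero D], D₀ ≤ D →
      ∀ (χ : DirichletCharacter ℂ D) (β : ℝ), IsCloseRealZero χ β →
        ‖χ.LFunction 1‖ ≤ C * ((1 - β) * Real.log D ^ 2 / Real.log (eta D β)) := by
  obtain ⟨c₁, c₂, _, hc₂, D₁, h1⟩ := h21
  obtain ⟨C, hC, D₂, h2⟩ := h37
  refine ⟨c₂ * C, mul_pos hc₂ hC, max D₁ D₂, fun D _ hD χ β hχ => ?_⟩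
  have hA := (h1 D (le_trans (le_max_left _ _) hD) χ β hχ).2
  have hB := h2 D (le_trans (le_max_right _ _) hD) χ β hχ
  have hb : 0 ≤ 1 - β := hχ.sub_pos.le
  calc ‖χ.LFunction 1‖ ≤ c₂ * ((1 - β) * smoothSum χ β D) := hA
    _ ≤ c₂ * ((1 - β) * (C * Real.log D ^ 2 / Real.log (eta D β))) := by
        gcongr
    _ = c₂ * C * ((1 - β) * Real.log D ^ 2 / Real.log (eta D β)) := by ring

/-- `log log D ≤ 2 √(log D)` for `D ≥ 3` (from `log t ≤ t − 1 < t` at `t = √(log D)`). [folklore] -/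
private theorem log_log_le_two_sqrt_log {D : ℝ} (hD : 3 ≤ D) :
    Real.log (Real.log D) ≤ 2 * Real.sqrt (Real.log D) := by
  have hlog : 0 < Real.log D := Real.log_pos (by linarith)
  have hs : 0 < Real.sqrt (Real.log D) := Real.sqrt_pos.mpr hlog
  have h1 : Real.log (Real.sqrt (Real.log D)) ≤ Real.sqrt (Real.log D) - 1 :=
    Real.log_le_sub_one_of_pos hs
  have h2 : Real.log (Real.log D) = 2 * Real.log (Real.sqrt (Real.log D)) := by
    conv_lhs => rw [← Real.sq_sqrt hlog.le]
    rw [Real.log_pow]; norm_num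
  rw [h2]; linarith

/-- **Theorem 2 from (4.1)** (PROVED, as printed: "if `β` satisfies (1.7) then `η ≫ log D` and
(4.1) gives (1.6)"): for every `A > 0` there are `C > 0` and `D₀` such that for `D ≥ D₀`, a real
primitive `χ` of conductor `D` and a real zero `β < 1` of `L(s,χ)` with
`1 − β ≤ A (log D)^{−3} log log D` force `L(1,χ) ≤ C/log D`.
[cite: FriedlanderIwaniec2018Note, §1 Theorem 2 and §4] -/
theorem theorem2_of (h21 : fi2018_proposition21) (h37 : fi2018_eq37) :
    ∀ A : ℝ, 0 < A → ∃ C : ℝ, 0 < C ∧ ∃ D₀ : ℕ, ∀ (D : ℕ) [NeZero D], D₀ ≤ D → 3 ≤ D →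
      ∀ (χ : DirichletCharacter ℂ D) (β : ℝ), χ.IsPrimitive → χ.IsQuadratic →
        χ.LFunction (β : ℂ) = 0 → β < 1 →
        1 - β ≤ A * Real.log (Real.log D) / Real.log D ^ 3 →
        ‖χ.LFunction 1‖ ≤ C / Real.log D := by
  intro A hA
  obtain ⟨C, hC, D₁, h41⟩ := eq41_of h21 h37
  -- threshold: `log D ≥ max (36 A², e)`; then `A log log D ≤ 2A √(log D) ≤ (log D)/3`.
  obtain ⟨D₂, hD₂⟩ : ∃ D₂ : ℕ, ∀ D : ℕ, D₂ ≤ D → max (36 * A ^ 2) (Real.exp 1) ≤ Real.log D := by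
    refine ⟨⌈Real.exp (max (36 * A ^ 2) (Real.exp 1))⌉₊ + 1, fun D hD => ?_⟩
    have hD' : Real.exp (max (36 * A ^ 2) (Real.exp 1)) ≤ D := by
      have := Nat.le_ceil (Real.exp (max (36 * A ^ 2) (Real.exp 1)))
      have h2 : (⌈Real.exp (max (36 * A ^ 2) (Real.exp 1))⌉₊ : ℝ) + 1 ≤ D := by exact_mod_cast hD
      linarith
    rw [Real.le_log_iff_exp_le (lt_of_lt_of_le (Real.exp_pos _) hD')]
    exact hD'
  refine ⟨C * A, mul_pos hC hA, max D₁ D₂, fun D _ hD hD3 χ β hprim hquad hzero hlt hclose => ?_⟩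
  have hDr : (3 : ℝ) ≤ D := by exact_mod_cast hD3
  have hL := hD₂ D (le_trans (le_max_right _ _) hD)
  have hL36 : 36 * A ^ 2 ≤ Real.log D := le_trans (le_max_left _ _) hL
  have hLe : Real.exp 1 ≤ Real.log D := le_trans (le_max_right _ _) hL
  have hlog : 0 < Real.log D := lt_of_lt_of_le (Real.exp_pos 1) hLe
  -- `log log D ≥ 1`
  have hll1 : 1 ≤ Real.log (Real.log D) := by
    rw [Real.le_log_iff_exp_le hlog]; exact hLe
  have hll : 0 < Real.log (Real.log D) := by linarith
  -- `A log log D ≤ (log D)/3`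
  have hsq : Real.sqrt (Real.log D) ≥ 6 * A := by
    rw [ge_iff_le, show 6 * A = Real.sqrt ((6 * A) ^ 2) by rw [Real.sqrt_sq (by linarith)]]
    exact Real.sqrt_le_sqrt (by nlinarith)
  have hAll : A * Real.log (Real.log D) ≤ Real.log D / 3 := by
    have h1 := log_log_le_two_sqrt_log hDr
    have h2 : Real.sqrt (Real.log D) * Real.sqrt (Real.log D) = Real.log D := Real.mul_self_sqrt hlog.le
    nlinarith [Real.sqrt_nonneg (Real.log D)]
  -- the standing assumption `1 − β ≤ 1/(3 log D)`
  have hclose' : 1 - β ≤ 1 / (3 * Real.log D) := by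
    calc 1 - β ≤ A * Real.log (Real.log D) / Real.log D ^ 3 := hclose
      _ ≤ (Real.log D / 3) / Real.log D ^ 3 := by gcongr
      _ = 1 / (3 * Real.log D) * (1 / Real.log D) := by field_simp
      _ ≤ 1 / (3 * Real.log D) * 1 := by
          gcongr
          rw [div_le_one hlog]
          linarith [Real.add_one_le_exp (1 : ℝ)]
      _ = 1 / (3 * Real.log D) := mul_one _
  have hχ : IsCloseRealZero χ β := ⟨hD3, hprim, hquad, hzero, hlt, hclose'⟩
  have hb : 0 < 1 - β := hχ.sub_pos
  -- `η ≥ (log D)³/(A log log D) · (1/log D)`… we only need `log η ≥ log log D`: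
  -- `η = 1/((1−β) log D) ≥ (log D)²/(A log log D) ≥ log D` because `A log log D ≤ log D`.
  have hη : Real.log D ≤ eta D β := by
    unfold eta
    rw [le_div_iff₀ (mul_pos hb hlog)]
    have h3 : (1 - β) * Real.log D ^ 3 ≤ A * Real.log (Real.log D) := by
      have := hclose; rw [le_div_iff₀ (by positivity)] at this; exact this
    nlinarith
  have hlogη : Real.log (Real.log D) ≤ Real.log (eta D β) := Real.log_le_log hlog hη
  have hmain := h41 D (le_trans (le_max_left _ _) hD) χ β hχ
  calc ‖χ.LFunction 1‖ ≤ C * ((1 - β) * Real.log D ^ 2 / Real.log (eta D β)) := hmain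
    _ ≤ C * ((A * Real.log (Real.log D) / Real.log D ^ 3) * Real.log D ^ 2 /
          Real.log (Real.log D)) := by
        gcongr
    _ = C * A / Real.log D := by
        field_simp

/-- **(6.6) from two-sided bounds of the shape (6.5)** (PROVED bookkeeping): if
`c₁ ω/log log D ≤ L ≤ c₂ ω log log D` with `ω = min{1, (1−β) log log D}` and
`(1 − β) log log D ≤ A` (`A ≥ 1`), then `(c₁/A)(1 − β) ≤ L ≤ c₂ (1 − β)(log log D)²`
(for `log log D > 0`). [cite: FriedlanderIwaniec2018Note, §6 (6.5)–(6.6)] -/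
theorem eq66_of_eq65_shape {D : ℕ} {β L c₁ c₂ A : ℝ} (hc₁ : 0 < c₁) (hc₂ : 0 < c₂) (hA : 1 ≤ A)
    (hll : 0 < Real.log (Real.log D)) (hb : 0 < 1 - β)
    (hlow : c₁ * omega D β / Real.log (Real.log D) ≤ L)
    (hup : L ≤ c₂ * omega D β * Real.log (Real.log D))
    (hsmall : (1 - β) * Real.log (Real.log D) ≤ A) :
    c₁ / A * (1 - β) ≤ L ∧ L ≤ c₂ * ((1 - β) * Real.log (Real.log D) ^ 2) := by
  have hω_le : omega D β ≤ (1 - β) * Real.log (Real.log D) := min_le_right _ _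
  have hω_ge : (1 - β) * Real.log (Real.log D) / A ≤ omega D β := by
    unfold omega
    rw [le_min_iff]
    constructor
    · rw [div_le_one (by linarith)]; exact hsmall
    · rw [div_le_iff₀ (by linarith)]
      have : 0 ≤ (1 - β) * Real.log (Real.log D) := by positivity
      nlinarith
  constructor
  · calc c₁ / A * (1 - β) = c₁ * ((1 - β) * Real.log (Real.log D) / A) / Real.log (Real.log D) := by
          field_simp
      _ ≤ c₁ * omega D β / Real.log (Real.log D) := by gcongr
      _ ≤ L := hlow
  · calc L ≤ c₂ * omega D β * Real.log (Real.log D) := hup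
      _ ≤ c₂ * ((1 - β) * Real.log (Real.log D)) * Real.log (Real.log D) := by gcongr
      _ = c₂ * ((1 - β) * Real.log (Real.log D) ^ 2) := by ring

end FI2018


/-! ### (6.5) and (6.6) from Theorem 3 (PROVED: Mertens' `Σ_{p ≤ y} 1/p ≤ log log y + 4` of the
tree's `MertensElementary.lean` bounds `|Σ_{p ≤ log D} χ(p)/p|`) -/

namespace FI2018

/-- A zero `β > 3/4` of `L(s,χ)`, `χ` primitive of conductor `D ≥ 3`, has `β < 1`: `L(s,χ) ≠ 0` on
`Re s ≥ 1` (Mathlib `DirichletCharacter.LFunction_ne_zero_of_one_le_re`; `χ ≠ 1` since the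
trivial character has conductor `1 ≠ D`). [cite: FriedlanderIwaniec2018Note, §6 Theorem 3] -/
theorem OnlyZeroBeyond.lt_one {D : ℕ} [NeZero D] {χ : DirichletCharacter ℂ D} {β : ℝ}
    (h : OnlyZeroBeyond χ β) : β < 1 := by
  by_contra hβ
  push Not at hβ
  have hχ1 : χ ≠ 1 := by
    intro h1
    have hc : χ.conductor = D := h.isPrimitive
    rw [h1, DirichletCharacter.conductor_one] at hc
    have := h.three_le
    omega
  have hne := DirichletCharacter.LFunction_ne_zero_of_one_le_re χ (s := (β : ℂ)) (Or.inl hχ1)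
    (by simpa using hβ)
  exact hne h.zero

/-- `|Σ_{p ≤ log D} χ(p)/p| ≤ Σ_{p ≤ ⌊log D⌋} 1/p ≤ log log ⌊log D⌋ + 4` (`|χ(p)| ≤ 1` and the
tree's explicit Mertens bound `sum_inv_prime_le`). [cite: FriedlanderIwaniec2018Note, §6 (6.3)–(6.5)] -/
theorem abs_primeSum_le {D : ℕ} [NeZero D] (χ : DirichletCharacter ℂ D)
    (hD : 2 ≤ ⌊Real.log D⌋₊) :
    |primeSum χ| ≤ Real.log (Real.log (⌊Real.log D⌋₊ : ℕ)) + 4 := by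
  unfold primeSum
  have hset : (Icc 1 ⌊Real.log D⌋₊).filter Nat.Prime = Nat.primesLE ⌊Real.log D⌋₊ := by
    ext p
    simp only [Finset.mem_filter, Finset.mem_Icc, Nat.mem_primesLE]
    constructor
    · rintro ⟨⟨-, hp⟩, hpr⟩
      exact ⟨hp, hpr⟩
    · rintro ⟨hp, hpr⟩
      exact ⟨⟨hpr.one_le, hp⟩, hpr⟩
  calc |∑ p ∈ (Icc 1 ⌊Real.log D⌋₊).filter Nat.Prime, (χ (p : ZMod D)).re / p|
      ≤ ∑ p ∈ (Icc 1 ⌊Real.log D⌋₊).filter Nat.Prime, |(χ (p : ZMod D)).re / p| :=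
        Finset.abs_sum_le_sum_abs _ _
    _ ≤ ∑ p ∈ (Icc 1 ⌊Real.log D⌋₊).filter Nat.Prime, (1 : ℝ) / p := by
        refine Finset.sum_le_sum fun p _ => ?_
        rw [abs_div, Nat.abs_cast]
        gcongr
        exact (Complex.abs_re_le_norm _).trans (χ.norm_le_one _)
    _ = ∑ p ∈ Nat.primesLE ⌊Real.log D⌋₊, (1 : ℝ) / p := by rw [hset]
    _ ≤ Real.log (Real.log (⌊Real.log D⌋₊ : ℕ)) + 4 := MertensBound.sum_inv_prime_le _ hD

/-- `e² < 8` (from Mathlib's `Real.exp_one_lt_d9`). [folklore] -/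
private theorem exp_two_lt_eight : Real.exp 2 < 8 := by
  have h := Real.exp_one_lt_d9
  have h0 := Real.exp_pos 1
  have : Real.exp 2 = Real.exp 1 * Real.exp 1 := by rw [← Real.exp_add]; norm_num
  rw [this]
  nlinarith

/-- For `D ≥ 8`: `N = ⌊log D⌋ ≥ 2`, `0 < log N ≤ log log D`. [folklore] -/
private theorem floor_log_facts {D : ℕ} (hD : 8 ≤ D) :
    2 ≤ ⌊Real.log D⌋₊ ∧ 0 < Real.log (⌊Real.log D⌋₊ : ℕ) ∧
      Real.log (⌊Real.log D⌋₊ : ℕ) ≤ Real.log (Real.log D) := by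
  have hD' : (8 : ℝ) ≤ D := by exact_mod_cast hD
  have hlogD : 2 ≤ Real.log D := by
    rw [Real.le_log_iff_exp_le (by linarith)]
    exact (exp_two_lt_eight.le).trans hD'
  have hN : 2 ≤ ⌊Real.log D⌋₊ := Nat.le_floor (by exact_mod_cast hlogD)
  have hN' : (2 : ℝ) ≤ (⌊Real.log D⌋₊ : ℕ) := by exact_mod_cast hN
  refine ⟨hN, Real.log_pos (by linarith), ?_⟩
  exact Real.log_le_log (by linarith) (Nat.floor_le (by linarith))

/-- `e^{Σ_{p ≤ log D} χ(p)/p} ≤ e⁴ log log D` for `D ≥ 8`. [cite: FriedlanderIwaniec2018Note, §6 (6.5)] -/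
theorem exp_primeSum_le {D : ℕ} [NeZero D] (χ : DirichletCharacter ℂ D) (hD : 8 ≤ D) :
    Real.exp (primeSum χ) ≤ Real.exp 4 * Real.log (Real.log D) := by
  obtain ⟨hN, hlogN, hle⟩ := floor_log_facts hD
  have h := abs_primeSum_le χ hN
  have h1 : primeSum χ ≤ Real.log (Real.log (⌊Real.log D⌋₊ : ℕ)) + 4 := (le_abs_self _).trans h
  calc Real.exp (primeSum χ) ≤ Real.exp (Real.log (Real.log (⌊Real.log D⌋₊ : ℕ)) + 4) :=
        Real.exp_le_exp.mpr h1
    _ = Real.exp 4 * Real.log (⌊Real.log D⌋₊ : ℕ) := by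
        rw [Real.exp_add, Real.exp_log hlogN, mul_comm]
    _ ≤ Real.exp 4 * Real.log (Real.log D) := by gcongr

/-- `e^{−4}/log log D ≤ e^{Σ_{p ≤ log D} χ(p)/p}` for `D ≥ 8`. [cite: FriedlanderIwaniec2018Note, §6 (6.5)] -/
theorem le_exp_primeSum {D : ℕ} [NeZero D] (χ : DirichletCharacter ℂ D) (hD : 8 ≤ D) :
    Real.exp (-4) / Real.log (Real.log D) ≤ Real.exp (primeSum χ) := by
  obtain ⟨hN, hlogN, hle⟩ := floor_log_facts hD
  have h := abs_primeSum_le χ hN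
  have h1 : -(Real.log (Real.log (⌊Real.log D⌋₊ : ℕ)) + 4) ≤ primeSum χ := by
    have := neg_abs_le (primeSum χ)
    linarith
  have hll : 0 < Real.log (Real.log D) := hlogN.trans_le hle
  calc Real.exp (-4) / Real.log (Real.log D) ≤ Real.exp (-4) / Real.log (⌊Real.log D⌋₊ : ℕ) := by
        gcongr
    _ = Real.exp (-(Real.log (Real.log (⌊Real.log D⌋₊ : ℕ)) + 4)) := by
        rw [neg_add, Real.exp_add, Real.exp_neg (Real.log _), Real.exp_log hlogN]
        ring
    _ ≤ Real.exp (primeSum χ) := Real.exp_le_exp.mpr h1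

/-- **(6.5), PROVED from Theorem 3**: "`ω (log log D)^{−1} ≪ L(1,χ) ≪ ω log log D`" — there are
`c₁, c₂ > 0` and `D₀` such that for `D ≥ D₀` and `(χ, β)` as in Theorem 3,
`c₁ ω/log log D ≤ L(1,χ) ≤ c₂ ω log log D`. [cite: FriedlanderIwaniec2018Note, §6 (6.5)] -/
theorem eq65_of_theorem3 (h : fi2018_theorem3) :
    ∃ c₁ c₂ : ℝ, 0 < c₁ ∧ 0 < c₂ ∧ ∃ D₀ : ℕ, ∀ (D : ℕ) [NeZero D], D₀ ≤ D →
      ∀ (χ : DirichletCharacter ℂ D) (β : ℝ), OnlyZeroBeyond χ β →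
        c₁ * omega D β / Real.log (Real.log D) ≤ ‖χ.LFunction 1‖ ∧
          ‖χ.LFunction 1‖ ≤ c₂ * omega D β * Real.log (Real.log D) := by
  obtain ⟨c₁, c₂, hc₁, hc₂, D₀, hmain⟩ := h
  refine ⟨c₁ * Real.exp (-4), c₂ * Real.exp 4, by positivity, by positivity, max D₀ 8, ?_⟩
  intro D _ hD χ β hχ
  have hD₀ : D₀ ≤ D := le_trans (le_max_left _ _) hD
  have h8 : 8 ≤ D := le_trans (le_max_right _ _) hD
  obtain ⟨-, hlogN, hle⟩ := floor_log_facts h8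
  have hll : 0 < Real.log (Real.log D) := hlogN.trans_le hle
  obtain ⟨hlow, hup⟩ := hmain D hD₀ χ β hχ
  have hω : 0 ≤ omega D β := by
    unfold omega
    exact le_min zero_le_one (by nlinarith [hχ.lt_one, hll])
  have hlo := le_exp_primeSum χ h8
  have hhi := exp_primeSum_le χ h8
  constructor
  · calc c₁ * Real.exp (-4) * omega D β / Real.log (Real.log D)
        = c₁ * omega D β * (Real.exp (-4) / Real.log (Real.log D)) := by ring
      _ ≤ c₁ * omega D β * Real.exp (primeSum χ) := by gcongr
      _ = c₁ * (omega D β * Real.exp (primeSum χ)) := by ring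
      _ ≤ ‖χ.LFunction 1‖ := hlow
  · calc ‖χ.LFunction 1‖ ≤ c₂ * (omega D β * Real.exp (primeSum χ)) := hup
      _ ≤ c₂ * (omega D β * (Real.exp 4 * Real.log (Real.log D))) := by gcongr
      _ = c₂ * Real.exp 4 * omega D β * Real.log (Real.log D) := by ring

/-- **(6.6), PROVED from Theorem 3**: "if `1 − β ≪ (log log D)^{−1}`, then
`1 − β ≪ L(1,χ) ≪ (1 − β)(log log D)²`" — for every `A ≥ 1` there are `c₁, c₂ > 0`, `D₀` with: for
`D ≥ D₀`, `(χ, β)` as in Theorem 3 and `(1 − β) log log D ≤ A`,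
`c₁ (1 − β) ≤ L(1,χ) ≤ c₂ (1 − β)(log log D)²` ((6.5) and the bookkeeping `eq66_of_eq65_shape`).
[cite: FriedlanderIwaniec2018Note, §6 (6.6)] -/
theorem eq66_of_theorem3 (h : fi2018_theorem3) {A : ℝ} (hA : 1 ≤ A) :
    ∃ c₁ c₂ : ℝ, 0 < c₁ ∧ 0 < c₂ ∧ ∃ D₀ : ℕ, ∀ (D : ℕ) [NeZero D], D₀ ≤ D →
      ∀ (χ : DirichletCharacter ℂ D) (β : ℝ), OnlyZeroBeyond χ β →
        (1 - β) * Real.log (Real.log D) ≤ A →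
          c₁ * (1 - β) ≤ ‖χ.LFunction 1‖ ∧
            ‖χ.LFunction 1‖ ≤ c₂ * ((1 - β) * Real.log (Real.log D) ^ 2) := by
  obtain ⟨c₁, c₂, hc₁, hc₂, D₀, hmain⟩ := eq65_of_theorem3 h
  refine ⟨c₁ / A, c₂, by positivity, hc₂, max D₀ 8, ?_⟩
  intro D _ hD χ β hχ hsmall
  have hD₀ : D₀ ≤ D := le_trans (le_max_left _ _) hD
  have h8 : 8 ≤ D := le_trans (le_max_right _ _) hD
  obtain ⟨-, hlogN, hle⟩ := floor_log_facts h8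
  have hll : 0 < Real.log (Real.log D) := hlogN.trans_le hle
  obtain ⟨hlow, hup⟩ := hmain D hD₀ χ β hχ
  exact eq66_of_eq65_shape hc₁ hc₂ hA hll (by linarith [hχ.lt_one]) hlow hup hsmall

end FI2018

end Literature.NumberTheory.LFunctions

end
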